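import Literature.MathematicalPhysics.QuantumFieldTheory.Balaban1983to89.B15Eq177ValueInvarianceCoDiv
import Literature.MathematicalPhysics.QuantumFieldTheory.Balaban1983to89.B15Eq177ValueInvarianceB
import Literature.MathematicalPhysics.QuantumFieldTheory.Balaban1983to89.Node00.LargeFieldBackgroundCoPOfRecordB

/-!
# `Balaban1983to89.B15Eq177ValueInvarianceCoDivB` — [Balaban1989LargeFieldI] (= [B15]) p. 194, the sentence after (1.77) *«The function is invariant with respect to the group of all
# gauge transformations defined on Λ»* AT THE BOND-LEVEL (2.12) DATA OF RECORD (node00-def-R's S2b `Node00.bgMSCoPOfRecordAtB ∕ bgMSCoPOfRecordB`, print's [Balaban1984PropagatorsII]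
# (2.3) datum) — the print-datum edition of `B15Eq177ValueInvarianceCoDiv` §3 (THEOREMS ONLY)

statement-level skeleton of published theorems with citation tags; proofs where landed; nothing here is a claim about
the Yang–Mills mass gap

Cell `pub-ymgap` (HUMAN RULINGS D-0062 ∕ D-0149), lane `pub-ymgap-dag-n12-c` g35 (R134 seat (a), N12 = [B15], s1); `--kind proof --supports` K1⁹ `stmt-QuantumFields-27364`;
count-neutral.  THEOREMS ONLY (0 `def`, 0 `instance`, 0 `sorry`).  (E1) variant (iii-b), class (β) of the lane's census-by-declaration (bus [DAGN12C-G35], 2026-08-30): the ONE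
declaration of `B15Eq177ValueInvarianceCoDiv` with a datum-bearing statement that N12's junction of record v14ᴸ (#10983) uses is `fun177std_bgMSCoPOfRecord_gaugeAct`; its bond-datum
edition (and the `At`-support edition) are one application of the lane's O `fun177stdB_bgOfRecordB_gaugeAct` with the parent's (datum-free) class-invariance lemma
`gaugeAct_mem_regMSCoPOfRecord(At)`; the class `regMSCoPOfRecord(At)` ([15] (2)) is print's, unchanged by the datum.

HONESTY GUARD (director-ym №338 (5)).  PURELY ADDITIVE: the (b)-keyed parent stays landed and true on its own text; the new binder `hbd` (the bond-datum family is empty above the standing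
range at `(k′, maxDomT M₁ Z)`) is DISPLAYED, and discharged for both families of record by O's `genSetDatumP_eq_empty_of_range ∕ lamDatumP_eq_empty_of_range` (§2).  No displayed premise
of any consumer is deleted or weakened.

WHAT IS HERE.  §1 ★★ `fun177stdB_bgMSCoPOfRecordAtB_gaugeAct` · ★★ `fun177stdB_bgMSCoPOfRecordB_gaugeAct` · `gaugeInvariant_fun177stdB_bgMSCoPOfRecordB`; §2 the two families of record:
`fun177stdB_bgMSCoPOfRecordB_gaugeAct_genSetDatumP` · ★ `fun177stdB_bgMSCoPOfRecordB_gaugeAct_lamDatumP` (print's [II] (2.3) datum, no range binder left).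

HONEST SCOPE.  Elementary bookkeeping; nothing of [15] Thm 1 asserted or used; count-neutral; N12 NOT discharged; K0⁷ ∕ K1⁹ NOT closed; one finite 𝕋⁴ programme at fixed ε — nothing
continuum ∕ ℝ⁴ ∕ OS; the Yang–Mills mass gap (Clay) is NOT proved by any of this.

References: [B15] = [Balaban1989LargeFieldI] (1.77) p.194; [15] = [Balaban1985Variational] (2) p.278, (181) p.307; [III] = [Balaban1988Convergent] (2.12) p.256, p.255; [II] =
[Balaban1984PropagatorsII] (2.3) p.224.
-/

noncomputable section

namespace Literature.MathematicalPhysics.QuantumFieldTheory.Balaban1983to89.B15Eq177ValueInvarianceCoDiv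

open Literature.MathematicalPhysics.QuantumFieldTheory.Balaban1983to89
open GaugeField Node00 T4Continuum B15DeterminingSets B15DeterminingSetsB B14.Eq213DetSet B15Sect1Instances B15Eq177ValueInvariance

/-! ## §1  p. 194's sentence at the bond-level (2.12) data of record -/

section RecordB

variable {F : T4Family} {N : ℕ} [NeZero N]

/-- ★★ **(1.77) IS GAUGE INVARIANT AT THE BOND-LEVEL DATUM ON A SUPPORT** `bgMSCoPOfRecordAtB F N ν K k Ω₀ Ω` (S2b), for every bond-datum family `bd` empty above the standing range at
`(k′, maxDomT M₁ Z)`: `A(U_{k′,Z}(V^u)) = A(U_{k′,Z}(V))`; twin of `fun177std_bgMSCoPOfRecordAt_gaugeAct`. [cite: Balaban1989LargeFieldI, (1.77) p.194; Balaban1985Variational, (2) p.278; Balaban1984PropagatorsII, (2.3) p.224] -/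
theorem fun177stdB_bgMSCoPOfRecordAtB_gaugeAct (ν : Stage7Numerics) (K k : ℕ) (Ω₀ : Set (Site (F.P K) 0)) (Ω : ℕ → Set (Site (F.P K) 0))
    (M₁ : ℕ) (bd : ℕ → (ℕ → Set (Site (F.P K) 0)) → BDetSet (F.P K)) (Z : Set (Site (F.P K) 0)) {k' : ℕ} (hk' : k' ≤ (F.P K).m + (F.P K).K)
    (hbd : ∀ j, (F.P K).m + (F.P K).K < j → bd k' (maxDomT M₁ Z) j = ∅)
    (u : GaugeTransf (F.P K) k' (SU N)) (Vk : GaugeField (F.P K) k' (SU N)) :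
    fun177stdB (bgMSCoPOfRecordAtB F N ν K k Ω₀ Ω) M₁ bd Z k' (gaugeAct u Vk) = fun177stdB (bgMSCoPOfRecordAtB F N ν K k Ω₀ Ω) M₁ bd Z k' Vk :=
  fun177stdB_bgOfRecordB_gaugeAct (avOfRecord F N K) (gaugeAct_mem_regMSCoPOfRecordAt ν K k Ω₀ Ω) M₁ bd Z hk' hbd u Vk

/-- ★★ **(1.77) IS GAUGE INVARIANT AT THE BOND-LEVEL DATUM OF RECORD** `bgMSCoPOfRecordB F N ν K k Ω` (S2b; support `suppDomOfRecord`), for every bond-datum family `bd` empty above the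
standing range at `(k′, maxDomT M₁ Z)`; twin of `fun177std_bgMSCoPOfRecord_gaugeAct` (the value-invariance letter of N12's chain at the re-pointed record).
[cite: Balaban1989LargeFieldI, (1.77) p.194; Balaban1985Variational, (2) p.278; Balaban1984PropagatorsII, (2.3) p.224] -/
theorem fun177stdB_bgMSCoPOfRecordB_gaugeAct (ν : Stage7Numerics) (K k : ℕ) (Ω : ℕ → Set (Site (F.P K) 0)) (M₁ : ℕ)
    (bd : ℕ → (ℕ → Set (Site (F.P K) 0)) → BDetSet (F.P K)) (Z : Set (Site (F.P K) 0)) {k' : ℕ} (hk' : k' ≤ (F.P K).m + (F.P K).K)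
    (hbd : ∀ j, (F.P K).m + (F.P K).K < j → bd k' (maxDomT M₁ Z) j = ∅)
    (u : GaugeTransf (F.P K) k' (SU N)) (Vk : GaugeField (F.P K) k' (SU N)) :
    fun177stdB (bgMSCoPOfRecordB F N ν K k Ω) M₁ bd Z k' (gaugeAct u Vk) = fun177stdB (bgMSCoPOfRecordB F N ν K k Ω) M₁ bd Z k' Vk :=
  fun177stdB_bgOfRecordB_gaugeAct (avOfRecord F N K) (gaugeAct_mem_regMSCoPOfRecord ν K k Ω) M₁ bd Z hk' hbd u Vk

/-- (1.77) at the bond-level datum of record as `GaugeField.GaugeInvariant`. [cite: Balaban1989LargeFieldI, (1.77) p.194] -/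
theorem gaugeInvariant_fun177stdB_bgMSCoPOfRecordB (ν : Stage7Numerics) (K k : ℕ) (Ω : ℕ → Set (Site (F.P K) 0)) (M₁ : ℕ)
    (bd : ℕ → (ℕ → Set (Site (F.P K) 0)) → BDetSet (F.P K)) (Z : Set (Site (F.P K) 0)) {k' : ℕ} (hk' : k' ≤ (F.P K).m + (F.P K).K)
    (hbd : ∀ j, (F.P K).m + (F.P K).K < j → bd k' (maxDomT M₁ Z) j = ∅) :
    GaugeInvariant (fun177stdB (bgMSCoPOfRecordB F N ν K k Ω) M₁ bd Z k') :=
  fun u Vk => fun177stdB_bgMSCoPOfRecordB_gaugeAct ν K k Ω M₁ bd Z hk' hbd u Vk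

/-! ## §2  The two families of record: reading (b) `genSetDatumP` and print's [II] (2.3) `lamDatumP` (no range binder left) -/

/-- (1.77) is gauge invariant at the bond-level datum of record read on READING (b)'s family `genSetDatumP` (= the parent's statement through S2b's `bgMSCoPOfRecordAtB_toDetBackground`,
here obtained directly). [cite: Balaban1989LargeFieldI, (1.77) p.194; Balaban1988Convergent, (2.13) pp.256–257] -/
theorem fun177stdB_bgMSCoPOfRecordB_gaugeAct_genSetDatumP (ν : Stage7Numerics) (K k : ℕ) (Ω : ℕ → Set (Site (F.P K) 0)) (M₁ : ℕ)
    (Z : Set (Site (F.P K) 0)) {k' : ℕ} (hk' : k' ≤ (F.P K).m + (F.P K).K) (u : GaugeTransf (F.P K) k' (SU N)) (Vk : GaugeField (F.P K) k' (SU N)) :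
    fun177stdB (bgMSCoPOfRecordB F N ν K k Ω) M₁ genSetDatumP Z k' (gaugeAct u Vk) = fun177stdB (bgMSCoPOfRecordB F N ν K k Ω) M₁ genSetDatumP Z k' Vk :=
  fun177stdB_bgMSCoPOfRecordB_gaugeAct ν K k Ω M₁ genSetDatumP Z hk' (genSetDatumP_eq_empty_of_range M₁ Z hk') u Vk

/-- ★ **(1.77) IS GAUGE INVARIANT AT THE BOND-LEVEL DATUM OF RECORD READ ON PRINT'S [II] (2.3) FAMILY `lamDatumP`** — the edition the re-attached N12 road consumes.
[cite: Balaban1989LargeFieldI, (1.77) p.194; Balaban1984PropagatorsII, (2.3) p.224] -/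
theorem fun177stdB_bgMSCoPOfRecordB_gaugeAct_lamDatumP (ν : Stage7Numerics) (K k : ℕ) (Ω : ℕ → Set (Site (F.P K) 0)) (M₁ : ℕ)
    (Z : Set (Site (F.P K) 0)) {k' : ℕ} (hk' : k' ≤ (F.P K).m + (F.P K).K) (u : GaugeTransf (F.P K) k' (SU N)) (Vk : GaugeField (F.P K) k' (SU N)) :
    fun177stdB (bgMSCoPOfRecordB F N ν K k Ω) M₁ lamDatumP Z k' (gaugeAct u Vk) = fun177stdB (bgMSCoPOfRecordB F N ν K k Ω) M₁ lamDatumP Z k' Vk :=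
  fun177stdB_bgMSCoPOfRecordB_gaugeAct ν K k Ω M₁ lamDatumP Z hk' (lamDatumP_eq_empty_of_range M₁ Z hk') u Vk

end RecordB

end Literature.MathematicalPhysics.QuantumFieldTheory.Balaban1983to89.B15Eq177ValueInvarianceCoDiv

end
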